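import Summits.ValiantsHypothesis.ValiantsHypothesis.Theorems.LangWeilTransferTameResolutionParam
import Summits.ValiantsHypothesis.ValiantsHypothesis.Theorems.LangWeilTransferTameResolutionNoetherLinear
import Summits.ValiantsHypothesis.ValiantsHypothesis.Theorems.LangWeilTransferTameResolutionMinimal
import Summits.ValiantsHypothesis.ValiantsHypothesis.Theorems.LangWeilTransferTameResolutionPoints
import Summits.ValiantsHypothesis.ValiantsHypothesis.Theorems.LangWeilTransferTameResolutionAssemblyPrelims

/-!
# LangWeilTransfer, support item `TameResolution` (stmt-ValiantsHypothesis-6378) — the qualitative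
# Kronecker parametrisation of every minimal component

Route `LangWeilTransfer` of `ValiantsHypothesis` (conditional route; honest framing: bookkeeping,
nothing here bears on VP ≠ VNP). The assembly of steps (N), (P) and (C, point condition) of the
architecture note of val-lit-p6 g9: for integer equations `S` and a minimal prime `𝔭` of
`(S) ⊂ ℚ[Y]` there are `r ≤ m`, `Q ∈ ℤ[U, T_1..T_r]` irreducible over `ℚ` with constant leading
`U`-coefficient `cQ ∈ ℤ ∖ 0`, `ρ ∈ ℤ[T] ∖ 0` and `V_i ∈ ℤ[U, T]` such that every point `x` of
`{Q = 0, ρ ≠ 0}` over `ℚ̄` yields the point `(V_i(x) / ρ(x'))_i` of `V(S)`. This is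
`TameResolution` without the component count (val-width's `…TameTransferModelCount`) and without
the degree / height bounds (the quantitative pass) — the algebraic skeleton on which both are hung.

* `tameResolution_qualitative`.
-/

noncomputable section

open MvPolynomial

-- the summit and the problem share the name `ValiantsHypothesis` (D-0017 single-conjunct layout)
set_option linter.dupNamespace false

namespace Summit.ValiantsHypothesis.ValiantsHypothesis.Theorems.LangWeilTransfer

/-- **Qualitative Kronecker parametrisation of a minimal component** (see the module docstring). -/
theorem tameResolution_qualitative {m t : ℕ} (S : Fin t → MvPolynomial (Fin m) ℤ)
    (𝔭 : Ideal (MvPolynomial (Fin m) ℚ))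
    (h𝔭 : 𝔭 ∈ (Ideal.span (Set.range fun i => MvPolynomial.map (Int.castRingHom ℚ) (S i))).minimalPrimes) :
    ∃ (r : ℕ) (Q : MvPolynomial (Fin (r + 1)) ℤ) (ρ : MvPolynomial (Fin r) ℤ)
      (V : Fin m → MvPolynomial (Fin (r + 1)) ℤ) (cQ : ℤ),
      r ≤ m ∧ cQ ≠ 0 ∧ ρ ≠ 0 ∧ (finSuccEquiv ℤ r Q).leadingCoeff = C cQ ∧
      0 < (finSuccEquiv ℤ r Q).natDegree ∧ Irreducible (MvPolynomial.map (Int.castRingHom ℚ) Q) ∧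
      ∀ x : Fin (r + 1) → AlgebraicClosure ℚ, aeval x Q = 0 → aeval (x ∘ Fin.succ) ρ ≠ 0 →
        ∀ i, aeval (fun j => aeval x (V j) / aeval (x ∘ Fin.succ) ρ) (S i) = 0 := by
  classical
  -- the generic point of the component
  haveI h𝔭P : 𝔭.IsPrime := h𝔭.1.1
  let A := MvPolynomial (Fin m) ℚ ⧸ 𝔭
  let F₀ := FractionRing A
  set π : MvPolynomial (Fin m) ℚ →+* F₀ := (algebraMap A F₀).comp (Ideal.Quotient.mk 𝔭) with hπ
  have hkerπ : RingHom.ker π = 𝔭 := by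
    ext f
    rw [RingHom.mem_ker, hπ, RingHom.comp_apply, map_eq_zero_iff _ (IsFractionRing.injective A F₀),
      Ideal.Quotient.eq_zero_iff_mem]
  set πℤ : MvPolynomial (Fin m) ℤ →+* F₀ := π.comp (MvPolynomial.map (Int.castRingHom ℚ)) with hπℤ
  have hkerℤ : RingHom.ker πℤ = 𝔭.comap (MvPolynomial.map (Int.castRingHom ℚ)) := by
    rw [hπℤ, ← RingHom.comap_ker, hkerπ]
  haveI : CharZero F₀ :=
    charZero_of_injective_ringHom (f := π.comp (C : ℚ →+* MvPolynomial (Fin m) ℚ)) (RingHom.injective _)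
  let y : Fin m → F₀ := fun i => πℤ (X i)
  have heval : eval₂Hom (Int.castRingHom F₀) y = πℤ := by
    refine MvPolynomial.ringHom_ext (fun z => ?_) (fun i => ?_)
    · simp only [eq_intCast, map_intCast]
    · simp only [eval₂Hom_X', y]
  -- (N) integer linear Noether position
  obtain ⟨r, n, Γ, hnr, hlin, hT, hint⟩ := exists_integer_noether_position_linear (F₀ := F₀) y
  simp only [heval] at hT hint
  set φ : MvPolynomial (Fin n) (MvPolynomial (Fin r) ℤ) →+* F₀ := πℤ.comp Γ.symm.toRingHom with hφ
  have hφΓ : ∀ f, φ (Γ f) = πℤ f := fun f => by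
    simp only [hφ, RingHom.comp_apply, RingEquiv.toRingHom_eq_coe, RingHom.coe_coe, RingEquiv.symm_apply_apply]
  set Tb : Fin r → F₀ := fun k => πℤ (Γ.symm (C (X k))) with hTb
  set θℚ : MvPolynomial (Fin r) ℚ →+* F₀ := (aeval Tb : MvPolynomial (Fin r) ℚ →ₐ[ℚ] F₀).toRingHom with hθℚ
  have hθℚX : ∀ k, θℚ (X k) = φ (C (X k)) := fun k => by
    simp only [hθℚ, AlgHom.toRingHom_eq_coe, RingHom.coe_coe, aeval_X, hTb, hφ, RingHom.comp_apply,
      RingEquiv.toRingHom_eq_coe, RingHom.coe_coe]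
  have hθℚinj : Function.Injective θℚ := by
    have := algebraicIndependent_iff_injective_aeval.1 hT
    exact this
  have hθ : θℚ.comp (MvPolynomial.map (Int.castRingHom ℚ)) = φ.comp MvPolynomial.C := by
    refine MvPolynomial.ringHom_ext (fun z => ?_) (fun k => ?_)
    · simp only [eq_intCast, map_intCast]
    · simp only [RingHom.comp_apply, map_X, hθℚX]
  have hθinj : Function.Injective (φ.comp MvPolynomial.C) := by
    rw [← hθ]
    exact hθℚinj.comp (MvPolynomial.map_injective _ (RingHom.injective_int (Int.castRingHom ℚ)))
  -- the transported system
  let S' : Fin t → MvPolynomial (Fin n) (MvPolynomial (Fin r) ℤ) := fun k => Γ (S k)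
  let d' : ℕ := Finset.univ.sup fun k => (S' k).totalDegree
  have hSd' : ∀ k, (S' k).totalDegree ≤ d' := fun k =>
    Finset.le_sup (f := fun k => (S' k).totalDegree) (Finset.mem_univ k)
  have hSπ : ∀ k, πℤ (S k) = 0 := fun k => by
    rw [← RingHom.mem_ker, hkerℤ, Ideal.mem_comap, ← hkerπ, RingHom.mem_ker, ← RingHom.mem_ker, hkerπ]
    exact h𝔭.1.2 (Ideal.subset_span ⟨k, rfl⟩)
  have hSφ : ∀ k, φ (S' k) = 0 := fun k => by rw [hφΓ]; exact hSπ k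
  have hmin := ringEquiv_minimal_transport S 𝔭 h𝔭 πℤ hkerℤ Γ
  have hint' : ∀ j, ∃ p : Polynomial (MvPolynomial (Fin r) ℚ), p.Monic ∧ (p.map θℚ).eval (φ (X j)) = 0 := by
    intro j
    obtain ⟨p, hpm, hp⟩ := hint j
    exact ⟨p, hpm, hp⟩
  have halg : ∀ j, ∃ P : Polynomial (MvPolynomial (Fin r) ℤ), P ≠ 0 ∧
      (P.map (φ.comp MvPolynomial.C)).eval (φ (X j)) = 0 := by
    intro j
    obtain ⟨p, hpm, hp⟩ := hint' j
    obtain ⟨P, hP0, hP⟩ := exists_int_relation_of_rat θℚ (φ (X j)) p hpm.ne_zero hp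
    exact ⟨P, hP0, by rw [← hθ]; exact hP⟩
  -- (P) the parametrisation in Noether position
  obtain ⟨Q, ρ, V, cQ, u, hcQ0, hρ0, hlc, hQdeg, hQℚirr, -, hgraph, hker⟩ :=
    exists_parametrisation S' hSd' φ θℚ hθℚX hθℚinj halg hint' hSφ hmin
  -- graph numerators of the ORIGINAL coordinates
  let c₀ : Fin m → MvPolynomial (Fin r) ℤ := fun i => coeff 0 (Γ (X i))
  let c : Fin m → Fin n → MvPolynomial (Fin r) ℤ := fun i j => coeff (Finsupp.single j 1) (Γ (X i))
  let W : Fin m → Polynomial (MvPolynomial (Fin r) ℤ) := fun i =>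
    Polynomial.C (c₀ i * ρ) + ∑ j, Polynomial.C (c i j) * V j
  have hW : ∀ i, y i * (φ.comp MvPolynomial.C) ρ = ((W i).map (φ.comp MvPolynomial.C)).eval u := by
    intro i
    have hyi : y i = φ (Γ (X i)) := by rw [hφΓ]
    have hdec := eq_C_add_sum_of_totalDegree_le_one (Γ (X i)) (hlin i)
    have hg' : ∀ j, φ (X j) * φ (C ρ) = Polynomial.eval u (Polynomial.map (φ.comp MvPolynomial.C) (V j)) := by
      intro j
      have hg := hgraph j
      simp only [RingHom.comp_apply] at hg
      exact hg
    rw [hyi, hdec]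
    simp only [W, c₀, c, map_add, map_sum, map_mul, Polynomial.map_add, Polynomial.map_sum,
      Polynomial.map_mul, Polynomial.map_C, Polynomial.eval_add, Polynomial.eval_finsetSum,
      Polynomial.eval_mul, Polynomial.eval_C, RingHom.comp_apply]
    rw [add_mul, Finset.sum_mul]
    simp only [mul_assoc, hg']
  -- the outputs
  refine ⟨r, (finSuccEquiv ℤ r).symm Q, ρ, fun i => (finSuccEquiv ℤ r).symm (W i), cQ, by omega, hcQ0, hρ0,
    by rw [AlgEquiv.apply_symm_apply]; exact hlc, by rw [AlgEquiv.apply_symm_apply]; exact hQdeg,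
    irreducible_map_finSuccEquiv_symm Q hQℚirr, ?_⟩
  intro x hxQ hxρ i
  let L := AlgebraicClosure ℚ
  set χ : Polynomial (MvPolynomial (Fin r) ℚ) →+* L :=
    Polynomial.eval₂RingHom (aeval (x ∘ Fin.succ) : MvPolynomial (Fin r) ℚ →ₐ[ℚ] L).toRingHom (x 0) with hχ
  have hχev : ∀ P : Polynomial (MvPolynomial (Fin r) ℤ),
      aeval x ((finSuccEquiv ℤ r).symm P) = χ (P.map (MvPolynomial.map (Int.castRingHom ℚ))) := by
    intro P
    rw [hχ, Polynomial.coe_eval₂RingHom]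
    exact aeval_finSuccEquiv_symm P x
  have hχC : ∀ g : MvPolynomial (Fin r) ℤ,
      χ (Polynomial.C (MvPolynomial.map (Int.castRingHom ℚ) g)) = aeval (x ∘ Fin.succ) g := by
    intro g
    rw [hχ, Polynomial.coe_eval₂RingHom, Polynomial.eval₂_C, AlgHom.toRingHom_eq_coe, RingHom.coe_coe]
    have : (Int.castRingHom ℚ) = algebraMap ℤ ℚ := rfl
    rw [this, aeval_map_algebraMap]
  have hχQ : χ (Q.map (MvPolynomial.map (Int.castRingHom ℚ))) = 0 := by rw [← hχev]; exact hxQ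
  have hχρ : χ (Polynomial.C (MvPolynomial.map (Int.castRingHom ℚ) ρ)) ≠ 0 := by rw [hχC]; exact hxρ
  -- the evaluation `ψ` at the generic point
  set ψ : Polynomial (MvPolynomial (Fin r) ℚ) →+* F₀ := Polynomial.eval₂RingHom θℚ u with hψ
  have hψmap : ∀ P : Polynomial (MvPolynomial (Fin r) ℤ),
      ψ (P.map (MvPolynomial.map (Int.castRingHom ℚ))) = (P.map (φ.comp MvPolynomial.C)).eval u := by
    intro P
    rw [hψ, Polynomial.coe_eval₂RingHom, Polynomial.eval₂_map, hθ, Polynomial.eval_map]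
  have hψρ : ψ (Polynomial.C (MvPolynomial.map (Int.castRingHom ℚ) ρ)) = (φ.comp MvPolynomial.C) ρ := by
    rw [← Polynomial.map_C, hψmap, Polynomial.map_C, Polynomial.eval_C]
  have hρψ : ψ (Polynomial.C (MvPolynomial.map (Int.castRingHom ℚ) ρ)) ≠ 0 := by
    rw [hψρ]
    exact fun h => hρ0 (hθinj (by rw [h, map_zero]))
  have hkerψ : ∀ G : Polynomial (MvPolynomial (Fin r) ℚ), ψ G = 0 →
      Q.map (MvPolynomial.map (Int.castRingHom ℚ)) ∣ G := by
    intro G hG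
    refine hker G ?_
    rw [Polynomial.eval_map, ← Polynomial.coe_eval₂RingHom, ← hψ]; exact hG
  have hy : ∀ i, y i * ψ (Polynomial.C (MvPolynomial.map (Int.castRingHom ℚ) ρ)) =
      ψ ((W i).map (MvPolynomial.map (Int.castRingHom ℚ))) := by
    intro i
    rw [hψρ, hψmap]; exact hW i
  -- the equations at the generic point
  have hintL : ∀ (R : Type _) [CommRing R] (f : ℤ →+* R), f = Int.castRingHom R :=
    fun R _ f => RingHom.ext_int f _
  have hS : MvPolynomial.eval y (MvPolynomial.map (ψ.comp (Polynomial.C.comp MvPolynomial.C))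
      (MvPolynomial.map (Int.castRingHom ℚ) (S i))) = 0 := by
    rw [MvPolynomial.map_map, hintL F₀ ((ψ.comp (Polynomial.C.comp MvPolynomial.C)).comp (Int.castRingHom ℚ)),
      MvPolynomial.eval_map, ← coe_eval₂Hom, heval]
    exact hSπ i
  have key := eval_div_eq_zero_of_kernel (MvPolynomial.map (Int.castRingHom ℚ) ρ)
    (fun i => (W i).map (MvPolynomial.map (Int.castRingHom ℚ))) (Q.map (MvPolynomial.map (Int.castRingHom ℚ)))
    (MvPolynomial.map (Int.castRingHom ℚ) (S i)) ψ hρψ hkerψ y hy hS χ hχQ hχρ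
  -- back to the statement
  rw [MvPolynomial.map_map, hintL L ((χ.comp (Polynomial.C.comp MvPolynomial.C)).comp (Int.castRingHom ℚ)),
    MvPolynomial.eval_map] at key
  have hpt : (fun j => χ ((W j).map (MvPolynomial.map (Int.castRingHom ℚ))) /
      χ (Polynomial.C (MvPolynomial.map (Int.castRingHom ℚ) ρ))) =
      fun j => aeval x ((finSuccEquiv ℤ r).symm (W j)) / aeval (x ∘ Fin.succ) ρ := by
    funext j; rw [hχev, hχC]
  rw [hpt] at key
  rw [MvPolynomial.aeval_def, hintL (AlgebraicClosure ℚ) (algebraMap ℤ (AlgebraicClosure ℚ))]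
  beta_reduce
  exact key

end Summit.ValiantsHypothesis.ValiantsHypothesis.Theorems.LangWeilTransfer
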